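import Summits.HodgeConjecture.HodgeConjecture.Theorems.F0P3cStCharTSJacCartanSocketCore     -- ★-cand (C8b-socket): `tubeJacobianLocal_of_chartData` (brings ★ C1–C5, C8a, C8b-*, Q1, Q4)
import Summits.HodgeConjecture.HodgeConjecture.Theorems.F0P3cStCharTSJacCartanModelData      -- ★-cand (C8b-data): `exists_conjFrame`, `exists_cartanData` (brings ★ C8b-field∕frame, ★ Q8, ★ C4m∕C4u)
import Summits.HodgeConjecture.HodgeConjecture.Theorems.F0P3cStCharTSLevelShift              -- ★ (Q11): `exists_uniform_level_shift₂`
import Literature.LinearAlgebra.Matrix.CentraliserOfSeparableCharpoly                       -- ★ `Matrix.commute_of_commute_of_charpoly_separable`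
import Literature.NumberTheory.Rogawski1990.LocalTransfer                                   -- ★ `IsRegularElt`
import HarnessLib

/-!
# F0 · P3c · line LH6 «StCharTS» — WIF antecedent, ELLIPTIC half: brick (C8b-model) «THE LOCAL TUBE-JACOBIAN SOCKET ON `U(σ,J)(K)` AT A COMPACT CARTAN»

Cell `pub/hodgecm-mathlib`, crux H413 = `stmt-HodgeConjecture-24833` (lane `--supports … --as helper`); seat LH5-p02 (g6); ROAD «JAC-ELL» v1 §2 (the model head).
For a characteristic-zero non-archimedean local field `K`, a continuous `σ : K →+* K`, a non-degenerate `J`, a REGULAR `γ₀ ∈ U(σ,J)(K)` with COMPACT centraliser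
`T′ = Z(γ₀)`, arbitrary Haar data `(ν, tm)` carrying the socket's instance classes, the conjugation family `Φ`, and a weight `D` that is locally constant on the regular
set and whose value at a regular `t₀` is the Haar character of the linear part `L = (Ad t₀⁻¹ − 1)|_𝔪 ⊕ id|_𝔱` of the tube map: **the local tube-Jacobian socket
(E1b) holds on the model** — `tubeJacobianLocal_elliptic_model`, the `hmodel` of ★ (Q9-CM) `tubeJacobianLocal_Gqs_of_forall_model` (A-p12).
THEOREMS ONLY; Mathlib + ★ (C4u∕C4m), (C8b-socket), (C8b-frame), (Q8), (Q11), ★ `CentraliserOfSeparableCharpoly`.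

Assembly: residue characteristic `q` gives the level ratio `α = |q|` and the `σ`-fixed scaling (★ C8b-frame); the compact `T′` is conjugated into `GL_N(𝒪)` by `Q`
(★ C8b-frame) and ★ (C4u) is fed with the CONJUGATED frame `ι = Q(·)Q⁻¹ ∘ subtype`, `ρ = Q(·)Q⁻¹ ∘ subtype` (so `ρ t₀^{±1}` are integral); ★ (Q8) over the fixed
field `F = K^σ` (★ C8b-field: `[K : K^σ] < ∞` for an involution) gives the
projections `pT`, `pM` (continuous: they are restrictions of the `K`-linear projection of ★ `…CartanDecompositionAd`) and the linear part `L` (continuous via ★ (Q8)'s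
`K`-linear `Φ`, open by the open mapping theorem); ★ (Q11) gives the uniform level shifts; the tube map `Θ` exists by the range description of `ι`; the chart link
`c Y ∈ T′ ↔ pM Y = 0` is ★ `commute_of_commute_of_charpoly_separable` + the Cayley commutation lemmas; then ★ (C8b-socket) `tubeJacobianLocal_of_chartData`.
HONEST LABEL: count-neutral; closes no organ by itself (the weight identification `D = DG²` and the transport to `Gqs L v` are ★ (Q9-CM)'s `hDD′`∕`hmodel` plumbing);
HC_CM is proved only modulo the 7 printed citations (2 remaining: hLiu418 = `stmt-HodgeConjecture-24832`, h413 = `stmt-HodgeConjecture-24833`) until rung 0 closes.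

## References
* [HarishChandra1970] Harish-Chandra (notes by G. van Dijk), *Harmonic Analysis on Reductive p-adic Groups*, LNM 162 (1970), Lemma 22. Context locator.
* [Rogawski1990] J. D. Rogawski, *Automorphic Representations of Unitary Groups in Three Variables* (1990), §12.5 p. 182. Context locator.
* [PlatonovRapinchuk1994] V. Platonov, A. Rapinchuk, *Algebraic Groups and Number Theory* (1994), §3.3. Context locator.
-/

set_option autoImplicit false
set_option linter.dupNamespace false

open Set Filter MeasureTheory MeasureTheory.Measure TopologicalSpace Topology Matrix ValuativeRel
open Literature.NumberTheory.Automorphic Literature.NumberTheory.Automorphic.UnitaryGroup Literature.NumberTheory.Weil1982.UnitaryFinTopForm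
open Literature.MeasureTheory.Group
open Literature.NumberTheory.Rogawski1990 (IsRegularElt isRegularElt_iff)
open Summit.HodgeConjecture.HodgeConjecture.Cruxes.H413.F0P3cStCharTSCayleyChartHaar
open Summit.HodgeConjecture.HodgeConjecture.Cruxes.H413.F0P3cStCharTSCayleyChartUnitary
open Summit.HodgeConjecture.HodgeConjecture.Cruxes.H413.F0P3cStCharTSCayleyChartUnitaryModel
open Summit.HodgeConjecture.HodgeConjecture.Cruxes.H413.F0P3cStCharTSTwistedTubeCore
open Summit.HodgeConjecture.HodgeConjecture.Cruxes.H413.F0P3cStCharTSJacCartanProduct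
open Summit.HodgeConjecture.HodgeConjecture.Cruxes.H413.F0P3cStCharTSJacCartanSocketCore
open Summit.HodgeConjecture.HodgeConjecture.Cruxes.H413.F0P3cStCharTSJacCartanModelFrame
open Summit.HodgeConjecture.HodgeConjecture.Cruxes.H413.F0P3cStCharTSJacCartanFixedField
open Summit.HodgeConjecture.HodgeConjecture.Cruxes.H413.F0P3cStCharTSJacCartanModelData
open Summit.HodgeConjecture.HodgeConjecture.Cruxes.H413.F0P3cStCharTSCartanDecompositionAd
open Summit.HodgeConjecture.HodgeConjecture.Cruxes.H413.F0P3cStCharTSCartanDecompositionSkew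
open Summit.HodgeConjecture.HodgeConjecture.Cruxes.H413.F0P3cStCharTSLevelShift
open scoped Pointwise Topology ENNReal NNReal MatrixGroups

namespace Summit.HodgeConjecture.HodgeConjecture.Cruxes.H413.F0P3cStCharTSJacCartanElliptic

variable {K : Type*} [Field K] [ValuativeRel K] [TopologicalSpace K] [IsNonarchimedeanLocalField K] [CharZero K] [SecondCountableTopology K] [T2Space K]
  {N : ℕ} (σ : K →+* K) (J : Matrix (Fin N) (Fin N) K)

/-! ## §1 The tube map exists (range description of `ι`) -/

omit [TopologicalSpace K] [IsNonarchimedeanLocalField K] [CharZero K] [SecondCountableTopology K] [T2Space K] in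
/-- **THE TUBE MAP `Θ` EXISTS**: for `Z` in the sub-box, `S(s·ι(pM Z)·s⁻¹, S(ι(pT Z), −ι(pM Z)))` is `J′`-skew (★ Q3 `cayleySandwich_skew_comm_of_valBound`, ★ Q8
`skew_conj_of_skew`), hence in the range of `ι`. [cite: HarishChandra1970, Lemma 22] [cite: PlatonovRapinchuk1994, §3.3] -/
theorem exists_twistedMap {V : Type*} [AddCommGroup V] (ι : V →+ Matrix (Fin N) (Fin N) K) (Λ Λ' : ℕ → AddSubgroup V) (pM pT : V →+ V)
    {α : ValueGroupWithZero K} {k : ℕ} (hΛ : ∀ j X, X ∈ Λ j ↔ ValBound (α ^ (j + 1)) (ι X)) (hα1 : α < 1) (h2 : (2 : K) ≠ 0)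
    (hΛ' : ∀ j Z, Z ∈ Λ' j ↔ (pM Z ∈ Λ j ∧ pT Z ∈ Λ j)) {J' : Matrix (Fin N) (Fin N) K}
    (hskewι : ∀ Z, ((ι Z).map σ)ᵀ * J' + J' * ι Z = 0) (hrange : ∀ X, (X.map σ)ᵀ * J' + J' * X = 0 → X ∈ Set.range ι)
    (s : GL (Fin N) K) (hs : ((s : Matrix (Fin N) (Fin N) K).map σ)ᵀ * J' * (s : Matrix (Fin N) (Fin N) K) = J')
    (hs1 : ValBound 1 (s : Matrix (Fin N) (Fin N) K)) (hsi1 : ValBound 1 ((s⁻¹ : GL (Fin N) K) : Matrix (Fin N) (Fin N) K)) :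
    ∃ Θ : V → V, ∀ Z ∈ Λ' k, ι (Θ Z) =
      (fun W X : Matrix (Fin N) (Fin N) K => (1 - W)⁻¹ * (W + X) * (1 + W * X)⁻¹ * (1 - W)) ((s : Matrix (Fin N) (Fin N) K) * ι (pM Z) * ((s⁻¹ : GL (Fin N) K) : Matrix (Fin N) (Fin N) K))
        ((fun W X : Matrix (Fin N) (Fin N) K => (1 - W)⁻¹ * (W + X) * (1 + W * X)⁻¹ * (1 - W)) (ι (pT Z)) (-ι (pM Z))) := by
  classical
  have hαk1 : α ^ (k + 1) < 1 := pow_lt_one₀ zero_le hα1 (Nat.succ_ne_zero k)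
  have hex : ∀ Z : V, ∃ Z' : V, Z ∈ Λ' k → ι Z' =
      (fun W X : Matrix (Fin N) (Fin N) K => (1 - W)⁻¹ * (W + X) * (1 + W * X)⁻¹ * (1 - W)) ((s : Matrix (Fin N) (Fin N) K) * ι (pM Z) * ((s⁻¹ : GL (Fin N) K) : Matrix (Fin N) (Fin N) K))
        ((fun W X : Matrix (Fin N) (Fin N) K => (1 - W)⁻¹ * (W + X) * (1 + W * X)⁻¹ * (1 - W)) (ι (pT Z)) (-ι (pM Z))) := by
    intro Z
    by_cases hZ : Z ∈ Λ' k
    · obtain ⟨hM, hT⟩ := (hΛ' k Z).1 hZ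
      have hMb : ValBound (α ^ (k + 1)) (ι (pM Z)) := (hΛ k _).1 hM
      have hTb : ValBound (α ^ (k + 1)) (ι (pT Z)) := (hΛ k _).1 hT
      have hMs' : ((-ι (pM Z)).map σ)ᵀ * J' + J' * (-ι (pM Z)) = 0 := by rw [← map_neg]; exact hskewι (-pM Z)
      have hin := (cayleySandwich_skew_comm_of_valBound σ h2 (J := J') (x := 1) hTb hMb.neg hαk1 (hskewι (pT Z)) hMs'
        (by rw [mul_one, one_mul]) (by rw [mul_one, one_mul])).1
      have hinb : ValBound (α ^ (k + 1)) ((1 - ι (pT Z))⁻¹ * (ι (pT Z) + -ι (pM Z)) * (1 + ι (pT Z) * -ι (pM Z))⁻¹ * (1 - ι (pT Z))) := by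
        simpa only [max_self] using valBound_cayleySandwich hTb hMb.neg hαk1 hαk1
      have hconj := skew_conj_of_skew σ J' s hs (hskewι (pM Z))
      have hconjb : ValBound (α ^ (k + 1)) ((s : Matrix (Fin N) (Fin N) K) * ι (pM Z) * ((s⁻¹ : GL (Fin N) K) : Matrix (Fin N) (Fin N) K)) :=
        valBound_conj hsi1 hs1 hMb
      have hout := (cayleySandwich_skew_comm_of_valBound σ h2 (J := J') (x := 1) hconjb hinb hαk1 hconj hin
        (by rw [mul_one, one_mul]) (by rw [mul_one, one_mul])).1
      obtain ⟨Z', hZ'⟩ := hrange _ hout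
      exact ⟨Z', fun _ => hZ'⟩
    · exact ⟨0, fun h => absurd h hZ⟩
  choose Θ hΘ using hex
  exact ⟨Θ, hΘ⟩

/-! ## §2 The chart link `c Y ∈ T′ ↔ pM Y = 0` -/

omit [CharZero K] [SecondCountableTopology K] [T2Space K] [TopologicalSpace K] [IsNonarchimedeanLocalField K] in
/-- **THE CHART LINK**: in the conjugated frame, a chart point `c Y` (`Y` in the base box) lies in `T′ = Z(γ₀)` iff `pM Y = 0` — ★ `commute_of_commute_of_charpoly_separable`
(the commutants of the commuting regular elements `t`, `γ₀` coincide) + ★ `cayley_comm_of_comm` ∕ ★ C8b-frame `comm_of_cayley_comm`. [cite: HarishChandra1970, Lemma 22]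
[cite: PlatonovRapinchuk1994, §3.3] -/
theorem chart_link {F : Subfield K} {𝔲 : Submodule ↥F (Matrix (Fin N) (Fin N) K)} (ι : ↥𝔲 →+ Matrix (Fin N) (Fin N) K)
    (ρ : ↥(unitaryGroupOfForm σ J) →* GL (Fin N) K) (Q : GL (Fin N) K) {J' : Matrix (Fin N) (Fin N) K}
    (hιapp : ∀ Z : ↥𝔲, ι Z = (Q : Matrix (Fin N) (Fin N) K) * Z.1 * ((Q⁻¹ : GL (Fin N) K) : Matrix (Fin N) (Fin N) K))
    (hρapp : ∀ g : ↥(unitaryGroupOfForm σ J), ρ g = Q * g.1 * Q⁻¹) (hρinj : Function.Injective ρ)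
    (hρr : ∀ g : GL (Fin N) K, g ∈ Set.range ρ ↔ ((((g : Matrix (Fin N) (Fin N) K)).map σ)ᵀ * J' * (g : Matrix (Fin N) (Fin N) K) = J' ∧
      (g : Matrix (Fin N) (Fin N) K) * 1 = 1 * (g : Matrix (Fin N) (Fin N) K)))
    (Λ : ℕ → AddSubgroup ↥𝔲) {α : ValueGroupWithZero K} (hΛ : ∀ j X, X ∈ Λ j ↔ ValBound (α ^ (j + 1)) (ι X)) (hα1 : α < 1) (h2 : (2 : K) ≠ 0)
    (c : ↥𝔲 → ↥(unitaryGroupOfForm σ J)) (hc : ∀ X ∈ Λ 0, ((ρ (c X) : GL (Fin N) K) : Matrix (Fin N) (Fin N) K) = cayley (ι X))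
    (pM pT : ↥𝔲 →+ ↥𝔲) (hsum : ∀ Z, pM Z + pT Z = Z) (t : GL (Fin N) K)
    (hpTcomm : ∀ Z, (pT Z).1 * (t : Matrix (Fin N) (Fin N) K) = (t : Matrix (Fin N) (Fin N) K) * (pT Z).1)
    (hkerpM : ∀ X : ↥𝔲, X.1 * (t : Matrix (Fin N) (Fin N) K) = (t : Matrix (Fin N) (Fin N) K) * X.1 → pM X = 0)
    (hsep : (t : Matrix (Fin N) (Fin N) K).charpoly.Separable) {γ₀ : ↥(unitaryGroupOfForm σ J)}
    (hγsep : ((γ₀.1 : GL (Fin N) K) : Matrix (Fin N) (Fin N) K).charpoly.Separable)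
    (htγ : Commute (t : Matrix (Fin N) (Fin N) K) ((γ₀.1 : GL (Fin N) K) : Matrix (Fin N) (Fin N) K))
    {T' : Subgroup ↥(unitaryGroupOfForm σ J)} (hT' : ∀ g, g ∈ T' ↔ g * γ₀ = γ₀ * g) :
    (∀ Y ∈ Λ 0, pM Y = 0 → c Y ∈ T') ∧ (∀ W ∈ Λ 0, c W ∈ T' → pM W = 0) := by
  set Qm : Matrix (Fin N) (Fin N) K := (Q : Matrix (Fin N) (Fin N) K) with hQmdef
  set Qi : Matrix (Fin N) (Fin N) K := ((Q⁻¹ : GL (Fin N) K) : Matrix (Fin N) (Fin N) K) with hQidef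
  set tGm : Matrix (Fin N) (Fin N) K := (t : Matrix (Fin N) (Fin N) K) with htGmdef
  set γm : Matrix (Fin N) (Fin N) K := ((γ₀.1 : GL (Fin N) K) : Matrix (Fin N) (Fin N) K) with hγmdef
  set Γm : Matrix (Fin N) (Fin N) K := ((ρ γ₀ : GL (Fin N) K) : Matrix (Fin N) (Fin N) K) with hΓmdef
  have hQQ : Qi * Qm = 1 := by rw [hQidef, hQmdef, ← Units.val_mul, inv_mul_cancel, Units.val_one]
  have hρcomm : ∀ g : ↥(unitaryGroupOfForm σ J), g ∈ T' ↔ ((ρ g : GL (Fin N) K) : Matrix (Fin N) (Fin N) K) * Γm = Γm * ((ρ g : GL (Fin N) K) : Matrix (Fin N) (Fin N) K) := by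
    intro g
    rw [hT', ← hρinj.eq_iff, map_mul, map_mul, Units.ext_iff, Units.val_mul, Units.val_mul]
  have hργ₀ : Γm = Qm * γm * Qi := by rw [hΓmdef, hρapp, Units.val_mul, Units.val_mul]
  constructor
  · intro Y hY hY0
    have hYT : pT Y = Y := by have := hsum Y; rwa [hY0, zero_add] at this
    have hYt : Commute Y.1 tGm := by have := hpTcomm Y; rwa [hYT] at this
    have hYγ : Commute Y.1 γm := Literature.LinearAlgebra.Matrix.commute_of_commute_of_charpoly_separable hsep hYt htγ.symm
    have hιY : ι Y * Γm = Γm * ι Y := by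
      rw [hιapp, hργ₀]
      calc Qm * Y.1 * Qi * (Qm * γm * Qi) = Qm * Y.1 * (Qi * Qm) * γm * Qi := by noncomm_ring
        _ = Qm * (Y.1 * γm) * Qi := by rw [hQQ]; noncomm_ring
        _ = Qm * (γm * Y.1) * Qi := by rw [hYγ.eq]
        _ = Qm * γm * (Qi * Qm) * Y.1 * Qi := by rw [hQQ]; noncomm_ring
        _ = _ := by noncomm_ring
    have hu : IsUnit (1 - ι Y).det := (isUnit_det_one_sub_of_valBound (valBound_of_mem_level_zero ι Λ hΛ hY) hα1).1
    rw [hρcomm, hc Y hY]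
    exact cayley_comm_of_comm hu hιY
  · intro W hW hWT
    have hcomm := (hρcomm _).1 hWT
    rw [hc W hW] at hcomm
    have hWb := valBound_of_mem_level_zero ι Λ hΛ hW
    have hU' : ((cayley (ι W)).map σ)ᵀ * J' * cayley (ι W) = J' := by
      have := ((hρr (ρ (c W))).1 ⟨c W, rfl⟩).1; rwa [hc W hW] at this
    have hιW : ι W * Γm = Γm * ι W := comm_of_cayley_comm σ h2 hWb hα1 hU' hcomm
    rw [hιapp, hργ₀] at hιW
    have hWγ : Commute W.1 γm := by
      show W.1 * γm = γm * W.1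
      calc W.1 * γm = (Qi * Qm) * W.1 * (Qi * Qm) * γm * (Qi * Qm) := by rw [hQQ, one_mul, mul_one, mul_one]
        _ = Qi * (Qm * W.1 * Qi * (Qm * γm * Qi)) * Qm := by noncomm_ring
        _ = Qi * ((Qm * γm * Qi) * (Qm * W.1 * Qi)) * Qm := by rw [hιW]
        _ = (Qi * Qm) * γm * (Qi * Qm) * W.1 * (Qi * Qm) := by noncomm_ring
        _ = _ := by rw [hQQ, one_mul, mul_one, mul_one]
    have hWt : Commute W.1 tGm := Literature.LinearAlgebra.Matrix.commute_of_commute_of_charpoly_separable hγsep hWγ htγ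
    exact hkerpM W hWt.eq

/-! ## §2b The base depth: uniform level shifts and the local-constancy window of the weight -/

omit [CharZero K] [SecondCountableTopology K] [T2Space K] in
/-- **THE BASE DEPTH `k`**: deep enough that `pM`, `pT`, `pM ∘ L⁻¹`, `pT ∘ L⁻¹` shift levels by at most `k` (★ Q11, scaling-equivariance) and that the weight `D` is
constant on the chart window `t₀ · c(Λ_k)` (local constancy of `D` at `t₀`, the chart images shrink to `1`). [cite: HarishChandra1970, Lemma 22] -/
theorem exists_depth {V : Type*} [AddCommGroup V] [TopologicalSpace V] [T2Space V] {G : Type*} [Group G] [TopologicalSpace G] [IsTopologicalGroup G]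
    (ι : V →+ Matrix (Fin N) (Fin N) K) (Λ : ℕ → AddSubgroup V) {α : ValueGroupWithZero K} (hι : IsClosedEmbedding ι)
    (hΛ : ∀ j X, X ∈ Λ j ↔ ValBound (α ^ (j + 1)) (ι X)) (hα : α ≠ 0) (hα1 : α < 1)
    (s : V ≃+ V) {π : K} (hsι : ∀ Z, ι (s Z) = π • ι Z) (hπ : valuation K π = α)
    (pM pT : V →+ V) (L : V ≃ₜ+ V) (hpMc : Continuous pM) (hpTc : Continuous pT)
    (hpMs : ∀ Z, pM (s Z) = s (pM Z)) (hpTs : ∀ Z, pT (s Z) = s (pT Z)) (hLss : ∀ Z, L.symm (s Z) = s (L.symm Z))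
    (c : V → G) (hcc : ContinuousOn c (Λ 0 : Set V)) (h0c : c 0 = 1) (hopenΛ : ∀ j, IsOpen (Λ j : Set V))
    {T' : Subgroup G} (t₀' : ↥T') (D : ↥T' → ℝ≥0) (hDlc : ∀ᶠ t in 𝓝 t₀', D t = D t₀') :
    ∃ k : ℕ, (∀ j, ∀ Z ∈ Λ (j + k), pM Z ∈ Λ j ∧ pT Z ∈ Λ j) ∧ (∀ j, ∀ Z ∈ Λ (j + k), pM (L.symm Z) ∈ Λ j ∧ pT (L.symm Z) ∈ Λ j) ∧
      (∀ t : ↥T', (t : G) ∈ (t₀' : G) • c '' (Λ k : Set V) → D t = D t₀') := by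
  have hanti := level_antitone ι Λ hΛ hα1.le
  obtain ⟨d₁, hd₁⟩ := exists_uniform_level_shift₂ ι Λ s hι hΛ hα hα1 hsι hπ (f := pM) (g := pT) hpMc.continuousAt (map_zero _) hpMs
    hpTc.continuousAt (map_zero _) hpTs
  obtain ⟨d₂, hd₂⟩ := exists_uniform_level_shift₂ ι Λ s hι hΛ hα hα1 hsι hπ (f := fun Z => pM (L.symm Z)) (g := fun Z => pT (L.symm Z))
    (hpMc.comp L.symm.continuous).continuousAt (by simp only [map_zero]) (fun Z => by simp only [hLss, hpMs])
    (hpTc.comp L.symm.continuous).continuousAt (by simp only [map_zero]) (fun Z => by simp only [hLss, hpTs])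
  obtain ⟨O, hOD, hOo, ht₀O⟩ := eventually_nhds_iff.1 hDlc
  obtain ⟨O', hO'o, hO'eq⟩ := isOpen_induced_iff.1 hOo
  have hmem1 : {g : G | (t₀' : G) * g ∈ O'} ∈ 𝓝 (1 : G) := by
    refine (hO'o.preimage (continuous_const.mul continuous_id)).mem_nhds ?_
    show (t₀' : G) * 1 ∈ O'
    rw [mul_one]
    have : t₀' ∈ Subtype.val ⁻¹' O' := by rw [hO'eq]; exact ht₀O
    exact this
  obtain ⟨j₁, hj₁⟩ := exists_image_level_subset Λ c hopenΛ (exists_level_subset_of_mem_nhds ι Λ hι hΛ hα1) hcc h0c _ hmem1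
  refine ⟨max (max d₁ d₂) j₁, fun j Z hZ => hd₁ j Z (hanti (by omega) hZ), fun j Z hZ => hd₂ j Z (hanti (by omega) hZ), ?_⟩
  rintro t ⟨_, ⟨Z, hZ, rfl⟩, ht⟩
  have ht' : (t₀' : G) * c Z = (t : G) := ht
  have hmem : (t : G) ∈ O' := by rw [← ht']; exact hj₁ ⟨Z, hanti (le_max_right _ _) hZ, rfl⟩
  have htO : t ∈ O := by rw [← hO'eq]; exact hmem
  rw [hOD t htO]

/-! ## §3 The model head -/

/-- **THE LOCAL TUBE-JACOBIAN SOCKET ON `U(σ,J)(K)` AT A COMPACT CARTAN `T′ = Z(γ₀)`** (`γ₀` regular): for arbitrary Haar data `(ν, tm)`, the conjugation family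
`Φ` and a weight `D` locally constant on the regular set with `D(t₀) = addEquivAddHaarChar L_{t₀}` (the linear part of the tube map on `𝔲(σ,J) = 𝔪 ⊕ 𝔱`), EVERY
regular `t₀ ∈ T′` has a neighbourhood `U ⊆ T′` and a Borel transversal class `A₀ ⊆ G⧸T′` of positive finite quotient mass with
`ν(Φ(A₀ × V)) = μ₀(A₀) · ∫⁻_V D dtm` for all Borel `V ⊆ U` — the `hmodel` of ★ (Q9-CM). [cite: HarishChandra1970, Lemma 22] [cite: Rogawski1990, §12.5 p. 182]
[cite: PlatonovRapinchuk1994, §3.3] -/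
theorem tubeJacobianLocal_elliptic_model (hσ : Continuous σ) (hσ2 : ∀ a, σ (σ a) = a) (hJ : IsUnit J.det)
    {γ₀ : ↥(unitaryGroupOfForm σ J)} (hγ₀ : IsRegularElt (γ₀ : GL (Fin N) K))
    {T' : Subgroup ↥(unitaryGroupOfForm σ J)} (hT' : ∀ g, g ∈ T' ↔ g * γ₀ = γ₀ * g) (hT'cpt : IsCompact (T' : Set ↥(unitaryGroupOfForm σ J)))
    [MeasurableSpace ↥(unitaryGroupOfForm σ J)] [BorelSpace ↥(unitaryGroupOfForm σ J)] [LocallyCompactSpace ↥(unitaryGroupOfForm σ J)]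
    [SecondCountableTopology ↥(unitaryGroupOfForm σ J)] [T2Space ↥(unitaryGroupOfForm σ J)]
    (hT'c : IsClosed (T' : Set ↥(unitaryGroupOfForm σ J)))
    [MeasurableSpace (↥(unitaryGroupOfForm σ J) ⧸ T')] [BorelSpace (↥(unitaryGroupOfForm σ J) ⧸ T')]
    (ν : Measure ↥(unitaryGroupOfForm σ J)) [ν.IsHaarMeasure] [ν.IsMulRightInvariant]
    (tm : Measure ↥T') [tm.IsMulLeftInvariant] [IsFiniteMeasureOnCompacts tm] [tm.IsOpenPosMeasure] [tm.IsInvInvariant]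
    (Φ : (↥(unitaryGroupOfForm σ J) ⧸ T') × ↥T' → ↥(unitaryGroupOfForm σ J))
    (hΦ : ∀ (x : ↥(unitaryGroupOfForm σ J)) (t : ↥T'), Φ (QuotientGroup.mk x, t) = x * t * x⁻¹)
    (D : ↥T' → ℝ≥0) (hDlc : ∀ t₀ : ↥T', IsRegularElt ((t₀ : ↥(unitaryGroupOfForm σ J)) : GL (Fin N) K) → ∀ᶠ t in 𝓝 t₀, D t = D t₀)
    (hDval : ∀ t₀ : ↥T', IsRegularElt ((t₀ : ↥(unitaryGroupOfForm σ J)) : GL (Fin N) K) →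
      ∀ (𝔲 : AddSubgroup (Matrix (Fin N) (Fin N) K)) [MeasurableSpace ↥𝔲] [BorelSpace ↥𝔲] [LocallyCompactSpace ↥𝔲],
        (∀ X, X ∈ 𝔲 ↔ (X.map σ)ᵀ * J + J * X = 0) → ∀ L : ↥𝔲 ≃ₜ+ ↥𝔲,
          (∀ X : ↥𝔲, (X : Matrix (Fin N) (Fin N) K) * (((t₀ : ↥(unitaryGroupOfForm σ J)) : GL (Fin N) K) : Matrix (Fin N) (Fin N) K) =
              (((t₀ : ↥(unitaryGroupOfForm σ J)) : GL (Fin N) K) : Matrix (Fin N) (Fin N) K) * X → L X = X) →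
          (∀ (X : ↥𝔲) (Y : Matrix (Fin N) (Fin N) K),
              (X : Matrix (Fin N) (Fin N) K) = (((t₀ : ↥(unitaryGroupOfForm σ J)) : GL (Fin N) K) : Matrix (Fin N) (Fin N) K) * Y *
                  ((((t₀ : ↥(unitaryGroupOfForm σ J)) : GL (Fin N) K)⁻¹ : GL (Fin N) K) : Matrix (Fin N) (Fin N) K) - Y →
              ((L X : ↥𝔲) : Matrix (Fin N) (Fin N) K) = ((((t₀ : ↥(unitaryGroupOfForm σ J)) : GL (Fin N) K)⁻¹ : GL (Fin N) K) : Matrix (Fin N) (Fin N) K) * X *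
                  (((t₀ : ↥(unitaryGroupOfForm σ J)) : GL (Fin N) K) : Matrix (Fin N) (Fin N) K) - X) →
          ((D t₀ : ℝ≥0) : ℝ≥0∞) = addEquivAddHaarChar L) :
    ∀ t₀ : ↥T', IsRegularElt ((t₀ : ↥(unitaryGroupOfForm σ J)) : GL (Fin N) K) →
      ∃ U : Set ↥T', IsOpen U ∧ t₀ ∈ U ∧
        ∃ A₀ : Set (↥(unitaryGroupOfForm σ J) ⧸ T'), MeasurableSet A₀ ∧ quotientMeasure T' tm hT'c ν A₀ ≠ 0 ∧ quotientMeasure T' tm hT'c ν A₀ ≠ ∞ ∧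
          ∀ V : Set ↥T', MeasurableSet V → V ⊆ U →
            (∀ t ∈ V, IsRegularElt ((t : ↥(unitaryGroupOfForm σ J)) : GL (Fin N) K)) →
            (∀ n : ↥(unitaryGroupOfForm σ J), n ∉ T' → ∀ t ∈ V, ∀ t' ∈ V, ((t' : ↥T') : ↥(unitaryGroupOfForm σ J)) ≠ n * t * n⁻¹) →
              ν (Φ '' (A₀ ×ˢ V)) = quotientMeasure T' tm hT'c ν A₀ * ∫⁻ t in V, (D t : ℝ≥0∞) ∂tm := by
  intro t₀' ht₀reg
  classical
  -- ### (0) names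
  set t₀ : ↥(unitaryGroupOfForm σ J) := (t₀' : ↥(unitaryGroupOfForm σ J)) with ht₀def
  have ht₀ : t₀ ∈ T' := t₀'.2
  set tG : GL (Fin N) K := t₀.1 with htGdef
  set tGm : Matrix (Fin N) (Fin N) K := (tG : Matrix (Fin N) (Fin N) K) with htGmdef
  set tGi : Matrix (Fin N) (Fin N) K := ((tG⁻¹ : GL (Fin N) K) : Matrix (Fin N) (Fin N) K) with htGidef
  set γm : Matrix (Fin N) (Fin N) K := ((γ₀.1 : GL (Fin N) K) : Matrix (Fin N) (Fin N) K) with hγmdef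
  have htU : (tGm.map σ)ᵀ * J * tGm = J := mem_unitaryGroupOfForm_iff.1 t₀.2
  have hsep : tGm.charpoly.Separable := (isRegularElt_iff _).1 ht₀reg
  have hγsep : γm.charpoly.Separable := (isRegularElt_iff _).1 hγ₀
  have htγ : Commute tGm γm := by
    have h := (hT' t₀).1 ht₀
    have h' := congrArg (fun g : ↥(unitaryGroupOfForm σ J) => ((g.1 : GL (Fin N) K) : Matrix (Fin N) (Fin N) K)) h
    simpa [Commute, SemiconjBy] using h'
  -- ### (1) scalars: the residue characteristic `q`, `α = |q| < 1`, `β = |2| α`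
  obtain ⟨q, hq0, hq1⟩ := exists_natCast_valuation_lt_one K
  set α : ValueGroupWithZero K := valuation K (q : K) with hαdef
  have hα : α ≠ 0 := by rw [hαdef, Ne, map_eq_zero]; exact hq0
  have hα1 : α < 1 := hq1
  have h2 : (2 : K) ≠ 0 := two_ne_zero
  have h2v : valuation K 2 ≠ 0 := by rw [Ne, map_eq_zero]; exact h2
  have hβ0 : valuation K 2 * α ≠ 0 := mul_ne_zero h2v hα
  have hβ : valuation K 2 * α < valuation K 2 := mul_lt_of_lt_one_right (zero_lt_iff.2 h2v) hα1
  -- ### (2) the compact Cartan is conjugated into the integral matrices by `Q`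
  obtain ⟨P, hP⟩ := exists_conj_valBound_one (T'.map (unitaryGroupOfForm σ J).subtype) (hT'cpt.image continuous_subtype_val)
  set Q : GL (Fin N) K := P⁻¹ with hQdef
  have hint : ∀ t : ↥(unitaryGroupOfForm σ J), t ∈ T' → ValBound 1 ((Q * t.1 * Q⁻¹ : GL (Fin N) K) : Matrix (Fin N) (Fin N) K) := by
    intro t ht; rw [hQdef, inv_inv]; exact hP _ ⟨t, ht, rfl⟩
  set Qm : Matrix (Fin N) (Fin N) K := (Q : Matrix (Fin N) (Fin N) K) with hQmdef
  set Qi : Matrix (Fin N) (Fin N) K := ((Q⁻¹ : GL (Fin N) K) : Matrix (Fin N) (Fin N) K) with hQidef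
  have hQQ : Qi * Qm = 1 := by rw [hQidef, hQmdef, ← Units.val_mul, inv_mul_cancel, Units.val_one]
  set J' : Matrix (Fin N) (Fin N) K := (Qi.map σ)ᵀ * J * Qi with hJ'def
  -- ### (3) the fixed field `F = K^σ`, the Lie algebra `𝔲 = 𝔲(σ,J)` over `F`, its Borel structure and Haar measure
  obtain ⟨F, hF⟩ := exists_fixedSubfield σ
  haveI : FiniteDimensional ↥F K := finiteDimensional_of_involutive σ h2 hσ2 F hF
  obtain ⟨𝔲, h𝔲⟩ := exists_fixedSubmodule_skew σ J F hF
  have h𝔲cl : IsClosed (𝔲 : Set (Matrix (Fin N) (Fin N) K)) := by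
    have : (𝔲 : Set (Matrix (Fin N) (Fin N) K)) = {X | (X.map σ)ᵀ * J + J * X = 0} := Set.ext fun X => h𝔲 X
    rw [this]; exact isClosed_setOf_skew σ J hσ
  letI : MeasurableSpace ↥𝔲 := borel _
  haveI : BorelSpace ↥𝔲 := ⟨rfl⟩
  haveI : LocallyCompactSpace (Matrix (Fin N) (Fin N) K) := inferInstanceAs (LocallyCompactSpace (Fin N → Fin N → K))
  haveI : LocallyCompactSpace ↥𝔲 := h𝔲cl.isClosedEmbedding_subtypeVal.locallyCompactSpace
  haveI : SecondCountableTopology (Matrix (Fin N) (Fin N) K) := inferInstanceAs (SecondCountableTopology (Fin N → Fin N → K))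
  haveI : SecondCountableTopology ↥𝔲 := h𝔲cl.isClosedEmbedding_subtypeVal.isEmbedding.secondCountableTopology
  set μ : Measure ↥𝔲 := Measure.addHaar with hμdef
  -- ### (4) the conjugated frame (★ C8b-data) and ★ (C4u)
  obtain ⟨ι, ρ, hιapp, hρapp, hι, hρ, hρinj, hιr, hρr⟩ := exists_conjFrame σ J hσ Q 𝔲 h𝔲
  obtain ⟨Λ, c, σV, hΛ, hc, hσV, hσVc, hwin, -, hchart'⟩ := exists_cayley_chart_haar σ J' 1 ι ρ μ ν hι hρ hρinj hιr hρr hα hα1 hβ0 hβ le_rfl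
  have hanti := level_antitone ι Λ hΛ hα1.le
  have hcc : ContinuousOn c (Λ 0 : Set ↥𝔲) := continuousOn_chart ι Λ ρ c hι.continuous hΛ hα1 hρ hc
  have hK0 : IsOpen (c '' (Λ 0 : Set ↥𝔲)) := isOpen_image_chart ι Λ ρ c σV hι hΛ hα hα1 hρ hρinj hc hσV hσVc hβ0 hwin
  have hcomp0 : IsCompact (Λ 0 : Set ↥𝔲) := isCompact_level ι Λ hι hΛ 0
  have hopenΛ := isOpen_level ι Λ hι.continuous hΛ hα
  have h0c : c 0 = 1 := chart_zero ι Λ ρ c hρinj hc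
  set κ : ℝ≥0∞ := μ (Λ 0 : Set ↥𝔲) / ν (c '' (Λ 0 : Set ↥𝔲)) with hκdef
  have hμ0 : μ (Λ 0 : Set ↥𝔲) ≠ 0 := (hopenΛ 0).measure_ne_zero μ ⟨0, zero_mem _⟩
  have hμt : μ (Λ 0 : Set ↥𝔲) ≠ ∞ := hcomp0.measure_lt_top.ne
  have hν0 : ν (c '' (Λ 0 : Set ↥𝔲)) ≠ 0 := hK0.measure_ne_zero ν ⟨1, ⟨0, zero_mem _, h0c⟩⟩
  have hνt : ν (c '' (Λ 0 : Set ↥𝔲)) ≠ ∞ := (hcomp0.image_of_continuousOn hcc).measure_lt_top.ne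
  have hκ0 : κ ≠ 0 := ENNReal.div_ne_zero.2 ⟨hμ0, hνt⟩
  have hκt : κ ≠ ∞ := ENNReal.div_ne_top hμt hν0
  have hchart : ∀ B ⊆ (Λ 0 : Set ↥𝔲), MeasurableSet (c '' B) → κ * ν (c '' B) = μ B := fun B hB hBm => (hchart' B hB hBm).symm
  -- ### (5) the Cartan data at `t₀` (★ C8b-data over `K^σ`)
  obtain ⟨pM, pT, L, hsum, hidem, hpMc, hpTc, hpTcomm, hkerpM, hLform, hLfix, hL𝔪', hpMs', hpTs', hLss'⟩ :=
    exists_cartanData σ J 𝔲 h𝔲 hJ tG htU hsep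
  set Tm : Matrix (Fin N) (Fin N) K := ((ρ t₀ : GL (Fin N) K) : Matrix (Fin N) (Fin N) K) with hTmdef0
  set Ti : Matrix (Fin N) (Fin N) K := (((ρ t₀)⁻¹ : GL (Fin N) K) : Matrix (Fin N) (Fin N) K) with hTidef0
  have hTm : Tm = Qm * tGm * Qi := by rw [hTmdef0, hρapp, Units.val_mul, Units.val_mul]
  have hTinv : Ti = Qm * tGi * Qi := by
    rw [hTidef0, hρapp, show (Q * tG * Q⁻¹)⁻¹ = Q * tG⁻¹ * Q⁻¹ by group, Units.val_mul, Units.val_mul]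
  have hT1 : ValBound 1 Tm := by rw [hTmdef0, hρapp]; exact hint t₀ ht₀
  have hTinv1 : ValBound 1 Ti := by rw [hTidef0, ← map_inv, hρapp]; exact hint t₀⁻¹ (T'.inv_mem ht₀)
  have hL : ∀ Z, ι (L Z) = Ti * ι (pM Z) * Tm - ι (pM Z) + ι (pT Z) := by
    intro Z
    rw [hιapp, hLform, hιapp, hιapp, hTm, hTinv]
    calc Qm * (tGi * (pM Z).1 * tGm - (pM Z).1 + (pT Z).1) * Qi
        = Qm * tGi * 1 * (pM Z).1 * 1 * tGm * Qi - Qm * (pM Z).1 * Qi + Qm * (pT Z).1 * Qi := by noncomm_ring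
      _ = _ := by rw [← hQQ]; noncomm_ring
  -- ### (6) the chart link
  obtain ⟨hcT, hTc⟩ := chart_link σ J ι ρ Q hιapp hρapp hρinj hρr Λ hΛ hα1 h2 c hc pM pT hsum tG hpTcomm hkerpM hsep hγsep htγ hT'
  -- ### (7) uniform level shifts (★ Q11, scaling by `q ∈ K^σ`), the local-constancy window of `D`, the base depth `k`, the sub-box
  have hqF : σ (q : K) = q := map_natCast σ q
  set qF : ↥F := ⟨(q : K), (hF _).2 hqF⟩ with hqFdef
  have hqF0 : qF ≠ 0 := fun h => hq0 (congrArg Subtype.val h)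
  let s : ↥𝔲 ≃+ ↥𝔲 := (LinearEquiv.smulOfUnit (Units.mk0 qF hqF0) : ↥𝔲 ≃ₗ[↥F] ↥𝔲).toAddEquiv
  have hsapp : ∀ Z : ↥𝔲, s Z = qF • Z := fun Z => by
    show (Units.mk0 qF hqF0 : (↥F)ˣ) • Z = qF • Z
    rw [Units.smul_mk0]
  have hsι : ∀ Z, ι (s Z) = (q : K) • ι Z := fun Z => by
    rw [hsapp, hιapp, hιapp, Submodule.coe_smul, Subfield.smul_def, Matrix.mul_smul, Matrix.smul_mul]
  obtain ⟨k, hshift, hshiftL, hD⟩ := exists_depth ι Λ hι hΛ hα hα1 s hsι hαdef.symm pM pT L hpMc hpTc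
    (fun Z => by rw [hsapp, hsapp, hpMs']) (fun Z => by rw [hsapp, hsapp, hpTs']) (fun Z => by rw [hsapp, hsapp, hLss']) c hcc h0c hopenΛ
    t₀' D (hDlc t₀' ht₀reg)
  obtain ⟨Λ', hΛ'⟩ := exists_subBox Λ pM pT
  -- ### (8) the product map `Ξ` and the tube map `Θ`
  let Ξ : ↥𝔲 → ↥𝔲 := fun Z => σV (pM Z) (pT Z)
  have hΞ : ∀ Z ∈ Λ' k, ι (Ξ Z) = (1 - ι (pM Z))⁻¹ * (ι (pM Z) + ι (pT Z)) * (1 + ι (pM Z) * ι (pT Z))⁻¹ * (1 - ι (pM Z)) := fun Z hZ => by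
    obtain ⟨hM, hT⟩ := (hΛ' k Z).1 hZ
    exact hσV _ (hanti (Nat.zero_le k) hM) _ (hanti (Nat.zero_le k) hT)
  have hskewι : ∀ Z : ↥𝔲, ((ι Z).map σ)ᵀ * J' + J' * ι Z = 0 := fun Z => ((hιr (ι Z)).1 ⟨Z, rfl⟩).1
  have hTunit : (Ti.map σ)ᵀ * J' * Ti = J' := ((hρr _).1 ⟨t₀⁻¹, by rw [map_inv]⟩).1
  obtain ⟨Θ, hΘ⟩ := exists_twistedMap σ ι Λ Λ' pM pT (k := k) hΛ hα1 h2 hΛ' hskewι (fun X hX => (hιr X).2 ⟨hX, by rw [mul_one, one_mul]⟩)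
    (ρ t₀)⁻¹ hTunit hTinv1 (by rw [inv_inv]; exact hT1)
  simp only [inv_inv] at hΘ
  -- ### (9) the value of the weight at `t₀`
  have hDχ : ((D ⟨t₀, ht₀⟩ : ℝ≥0) : ℝ≥0∞) = addEquivAddHaarChar L :=
    @hDval t₀' ht₀reg 𝔲.toAddSubgroup (borel ↥𝔲) ⟨rfl⟩ ‹LocallyCompactSpace ↥𝔲› (fun X => h𝔲 X) L hLfix hL𝔪'
  -- ### (10) ★ (C8b-socket)
  haveI : SigmaCompactSpace ↥T' := hT'c.isClosedEmbedding_subtypeVal.sigmaCompactSpace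
  haveI : SFinite tm := inferInstance
  obtain ⟨U, hUo, hU0, A₀, hA₀m, hA0, hAt, hV⟩ := tubeJacobianLocal_of_chartData ι Λ ρ c σV pM pT L Θ Ξ T' μ ν tm hT'c hι hΛ hα hα1 h2 hρinj hc hcc hK0 hσV hσVc
    hΛ' hsum hidem hpMc hpTc hshift hΞ hcT hTc ht₀ hT1 hTinv1 hL hΘ hshiftL hκ0 hκt hchart Φ hΦ D hD hDχ
  exact ⟨U, hUo, hU0, A₀, hA₀m, hA0, hAt, fun V hVm hVU _ _ => hV V hVm hVU⟩

end Summit.HodgeConjecture.HodgeConjecture.Cruxes.H413.F0P3cStCharTSJacCartanElliptic
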